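import Summits.QuantumFields.YangMills.Theorems.UnitScaleTiltProp7SectET3DeltaOneT3
import HarnessLib

/-!
# Route `UnitScaleTilt`, crux «MinimiserStabilityRegPr» (stmt-QuantumFields-19200, stub EX) ∕ (O″χ) B0 (stmt-QuantumFields-20520), node N06(d = 3), route (α) —
# DEFINITIONS FILE, LAYER 0 BRICK L0b PART 4: **THE J-TERM OF RECORD — PRINT'S `T_J(U₀)` OF [Balaban1985BackgroundPropagators] (3.127)–(3.128) CONCRETELY**, from the LINEAR term
# `⟨·, J⟩` of (3.7)∕(3.12) (the first Fréchet derivative of the symmetrised action along the chart), the QUADRATIC term `C⁽²⁾` of the averaging (3.14) (the second Fréchet derivative of the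
# re-based twisted log-chart `logChartTwS`, whose first derivative IS `QTwS`, ✓`Prop7SymAvgTwSymDefs`) and print's `H(U₀)` (3.126) (= ✓`Prop7SectET3DeltaPi.H46`); and **`Δ₁` OF RECORD
# `DeltaOneJ := DeltaOne … TJSlot`** with its letters `G₁`, `(QG₁Q*)⁻¹`, `H₁`, `𝔊 = G₁𝔓*` and readers BY NAME (brick L0b part 3's slot instances at `T_J := TJSlot`)

Cell `ym-inputs` (desk `pub/ym-inputs`, INPUT-LIST.md v9.1 §4 row p01 «keep the B0-definer lead: your list, your order»; predecessor notes `pub/ym-inputs/NOTES-p01-final.md` HANDOFF «(b) Δ₁ (3.128)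
letter (needs C² of the averaging = second derivative of logChartTwS, and J)»; LOCATE posted on `pub/ym3-torus/STATUS.md` 2026-08-28T11:47:20Z).  DEFINITIONS + `rfl`∕`simp` glue only (0 `sorry`);
`--kind definition --supports stmt-QuantumFields-20520 --as helper`; count-neutral.  YM₃ on T³ is ladder rung R3, NOT the Clay problem; nothing here is a claim about a stub, a crux, d = 4 or the
mass gap.

THE PRINT.  [Balaban1985BackgroundPropagators] p. 421 L4–11: *«In the future we will consider a non-linear variational problem, a generalization of the problem (3.109), (3.110) in which, among
other changes, the linear averaging operators in (3.110) are replaced by non-linear ones. To solve this problem the non-linear averaging operations have to be linearized, and a linearizing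
transformation creates new quadratic terms in an expansion of the action. Fortunately they are connected with the linear term in the expansion (3.12), so they are small because the configuration
J is small. Let us write a quadratic form replacing (3.109) in the variational problem»* — (3.127): `⟨A, ΔA⟩ − 2⟨HC⁽²⁾(A), J⟩`, *«C⁽²⁾(A) … a second order term in the expansion of Q_j(ηA) …
The operator H is defined by the problem (3.109), (3.110) … or we take H given by (3.126)»*; (3.128): `G₁` := the operator of the gauge-invariant extension (3.118)–(3.119) of that form
`+ ‖RD*A‖² + a‖QA‖²`; (3.129) `H₁B = G₁Q*(QG₁Q*)⁻¹B`; (3.12): `A^η(exp iηA U) = A^η(U) + ⟨A, J⟩ + ½⟨A, ΔA⟩ + ⋯`; (3.14): `(1∕η)Q_j(U, ηA) = Q_j(U)A + (1∕η)C_j(U, ηA)`, `C_j` analytic beginning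
with second-order terms.  [Balaban1985Variational] (110)–(111) p. 294: the same `G₁`, `𝔊 = G₁𝔓*` in the proof of Proposition 7.

WHY ∕ HOW (the reparametrisation principle that (3.127) encodes, in the route's exponent coordinates `X = iηA`).  Along the chart `X ↦ e^{X}U₀` of brick L0b the symmetrised action is
`𝒜(X) = 𝒜(0) + j[X] + ½h[X, X] + O(X³)` with `j := D𝒜(0)` (print's `⟨·, J⟩`; `actionGrad`) and `h := D²𝒜(0)` (`hessFormRe`, the form of `Δ^η(U₀)`), and the averaging constraint reads
`log U̿^{twS}(X) = Q X + ½q[X, X] + O(X³)` with `Q := QTwS U₀` and `q := D²(logChartTwS U₀)(0)` (print's `2C⁽²⁾` polarised; `avgHess`).  The substitution `X = X′ − H(½q[X′, X′])`, `H` a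
right inverse of `Q` (print: «we take H given by (3.126)» = `H46 U₀`, ✓`QTwS_Hf`), makes the constraint LINEAR to second order (`log U̿(X) = QX′ + O(X′³)`) and turns the action into
`𝒜(0) + j[X′] + ½(h[X′, X′] − j[H q[X′, X′]]) + O(X′³)`: the new quadratic form is `h + t_J` with **`t_J[X, Y] := −j(H(q[X, Y]))`** (`tjForm`) — print's `−2⟨HC⁽²⁾(A), J⟩`, bilinear,
symmetric where `q` is (Schwarz), vanishing when `j = 0` (critical background).  Read on brick L0a's weighted `L²` space EXACTLY as `Δ^η` is read from `h` in brick L0b (`hessSesqRe`: the factor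
`κ = −2c₀∕η²` and the real structure `σ` in the first slot), `t_J` gives the bounded operator **`TJ U₀`** (`⟪TJ U₀ v, w⟫ = κ·t_J[(toL2⁻¹v)ᴴ, toL2⁻¹w]`), so that `Δ^η(U₀) + T_J(U₀)` IS the
Hessian operator of the reparametrised action in print's normalisation; `TJSlot` is it in the slot type of ✓`DeltaOne`, and `DeltaOneJ := DeltaOne … TJSlot` is `Δ₁` with the J-term of
record (until now the tree instantiated the slot only at `T_J := 0`, ✓`DeltaOne_zero`: `Δ₁ = Δ_π`).

WHAT IS DEFINED (member `F`, `h : n ≤ K`, weights `c₀ cB`, `a`; background `U₀ : GaugeField (F.P K) 0 SU(2)`; `V := PBond (F.P K) 0 → M₂(ℂ)`): `actionGrad F K U₀ : V →L[ℂ] ℂ` (print's `⟨·, J⟩`);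
`avgHess F n K h U₀ : V →L[ℂ] V →L[ℂ] (PBond (F.P n) 0 → M₂(ℂ))` (print's `2C⁽²⁾`, polarised); `H46L F n K h c₀ cB a U₀` (✓`H46` as a continuous linear map); ★`tjForm … U₀ : V →L[ℂ] V →L[ℂ] ℂ`;
`tjSesq … U₀` (sesquilinear, `L²`); ★★`TJ … U₀ : BondL2K →L[ℂ] BondL2K`; `TJSlot …` (slot type); ★★`DeltaOneJ … := DeltaOne … (TJSlot …)`; BY NAME at the slot of record: `G1J`, `Kinv1J`, `H1J`,
`frakG1J` (Hilbert level) and the readers `HfJ`, `H1fJ`, `frakGfJ` in the EX binder types (✓`G1pi`∕`Kinv1pi`∕`H1pi`∕`frakG1pi`∕`HfOne`∕`H1fOne`∕`frakGfOne` at `TJ := TJSlot …`).  Glue: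
`actionGrad_def`, `avgHess_def`, `H46L_apply`, ★`tjForm_apply` (`t_J[X, Y] = −j(H(q[X, Y]))`), `tjSesq_apply`, ★`inner_TJ_left` (`⟪T_J v, w⟫ = tjSesq v w`), `TJSlot_apply`, `DeltaOneJ_def`,
★`tjForm_eq_zero_of_actionGrad_eq_zero` ∕ ★★`TJ_eq_zero_of_actionGrad_eq_zero` ∕ `DeltaOneJ_apply_eq_DeltaPi_of_actionGrad_eq_zero` (AT A CRITICAL BACKGROUND THE J-TERM VANISHES and `Δ₁ = Δ_π`
there — print p. 421: «they are small because the configuration J is small»; here the exact `J = 0` case).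
NOT HERE (rows ∕ N06): symmetry of `t_J` (Schwarz for `logChartTwS`, smooth near `0` at `RegPr` backgrounds — ★w5-20520's ✓`analyticOnNhd_logChartTwS`∕`differentiableAt_logChartTwS_of_regPr`),
reality (`σ`-commutation of `T_J`), the second-order Taylor identities `𝒜(X) = 𝒜(0) + j[X] + ½h[X,X] + o(‖X‖²)` ∕ `log U̿(X) = QX + ½q[X,X] + o(‖X‖²)` as theorems, the identification of `j` with
lit `Jcur` ((3.11) `J = D*η⁻²Im ∂U`), any SIZE of `T_J` (N06: `|J| = O(ε)`), positivity of `Δ₁ + DRD* + aQ*Q` (`PosOnto … DeltaOneJ`, Thm 3.11 — Track A).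
HONEST SCOPE.  Definitions; no estimate; nothing of print asserted; not a proof of any stub; nothing continuum ∕ OS ∕ mass-gap ∕ Clay.

References: T. Bałaban, CMP **99** (1985) 389–434 [Balaban1985BackgroundPropagators] ((3.7) p.391, (3.11)–(3.14) pp.392–393, (3.126)–(3.129) pp.420–421); CMP **102** (1985) 277–309
[Balaban1985Variational] ((44) p.285, (110)–(111) p.294).
-/

set_option autoImplicit false

noncomputable section

open scoped InnerProductSpace ComplexConjugate Matrix.Norms.L2Operator BigOperators

namespace Summit.QuantumFields.YangMills.Theorems.Prop7SectET3DeltaOne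

open Literature.MathematicalPhysics.QuantumFieldTheory.Balaban1983to89
open Literature.MathematicalPhysics.QuantumFieldTheory.Balaban1983to89.T3ContinuumYM3Torus
open T3SectALandauChart (eta eta_pos)
open B9SectCLatticeCarrier (Bond)
open B9Eq311L2Pairing (WL2)
open B11Eq115Space (NegSize Space115 JetSup NegSup)
open B11Eq111FrakG (nabla115)
open B11Eq103H1Complex (SiteL2K BondL2K)
open Summit.QuantumFields.YangMills.Theorems.Prop7SectET3Transport (periodsT3 bondEquiv bgOfCfg)
open Summit.QuantumFields.YangMills.Theorems.Prop7SectET3HilbertLetters (W₂ toL2 toL2B)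
open Summit.QuantumFields.YangMills.Theorems.Prop7SectET3CurvedPropagators (GT KinvT HT Hf H1f frakGT frakGfR)
open Summit.QuantumFields.YangMills.Theorems.Prop7SectET3WilsonHessian (chartU actionRe DeltaEta toL2CLM)
open Summit.QuantumFields.YangMills.Theorems.Prop7SectET3DeltaPi (gaugeCorr DeltaPi DeltaPiSlot H46)
open Summit.QuantumFields.YangMills.Theorems.Prop7SymAvgTwSym (logChartTwS QTwS)

/-! ## §1 The two Taylor coefficients print combines: `⟨·, J⟩` (3.12) and `2C⁽²⁾` (3.14) -/

section Coefficients

variable (F : T3Family) (n K : ℕ) (h : n ≤ K)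

/-- **PRINT'S LINEAR TERM `⟨·, J⟩` OF (3.7)∕(3.12) ALONG THE CHART OF RECORD**: the first Fréchet derivative at `X = 0` of the symmetrised action `X ↦ 𝒜(e^{X}U₀)` of brick L0b (exponent
coordinates; print's `⟨A, J⟩` at `X = iηA` up to the weight `η^{d−4}`). [cite: Balaban1985BackgroundPropagators, (3.7) p.391, (3.11)–(3.12) p.392] -/
def actionGrad (U₀ : GaugeField (F.P K) 0 (Matrix.specialUnitaryGroup (Fin 2) ℂ)) : (PBond (F.P K) 0 → Matrix (Fin 2) (Fin 2) ℂ) →L[ℂ] ℂ :=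
  fderiv ℂ (fun X : PBond (F.P K) 0 → Matrix (Fin 2) (Fin 2) ℂ => actionRe F K (chartU F K U₀ X)) 0

/-- **PRINT'S QUADRATIC TERM OF THE AVERAGING, POLARISED: `2C⁽²⁾(U₀)[X, Y]`** — the second Fréchet derivative at `X = 0` of the re-based twisted log-chart `X ↦ log U̿^{twS}(X)` (whose first
derivative is `QTwS U₀`, (3.14)). [cite: Balaban1985BackgroundPropagators, (3.13)–(3.14) p.393; Balaban1985Variational, (44) p.285] -/
def avgHess (U₀ : GaugeField (F.P K) 0 (Matrix.specialUnitaryGroup (Fin 2) ℂ)) :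
    (PBond (F.P K) 0 → Matrix (Fin 2) (Fin 2) ℂ) →L[ℂ] (PBond (F.P K) 0 → Matrix (Fin 2) (Fin 2) ℂ) →L[ℂ] (PBond (F.P n) 0 → Matrix (Fin 2) (Fin 2) ℂ) :=
  fderiv ℂ (fun X : PBond (F.P K) 0 → Matrix (Fin 2) (Fin 2) ℂ => fderiv ℂ (logChartTwS F n K h U₀) X) 0

variable {F n K h}

/-- Unfolding `actionGrad`. [cite: Balaban1985BackgroundPropagators, (3.12) p.392] -/
theorem actionGrad_def (U₀ : GaugeField (F.P K) 0 (Matrix.specialUnitaryGroup (Fin 2) ℂ)) :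
    actionGrad F K U₀ = fderiv ℂ (fun X : PBond (F.P K) 0 → Matrix (Fin 2) (Fin 2) ℂ => actionRe F K (chartU F K U₀ X)) 0 := rfl

/-- Unfolding `avgHess`. [cite: Balaban1985BackgroundPropagators, (3.14) p.393] -/
theorem avgHess_def (U₀ : GaugeField (F.P K) 0 (Matrix.specialUnitaryGroup (Fin 2) ℂ)) :
    avgHess F n K h U₀ = fderiv ℂ (fun X : PBond (F.P K) 0 → Matrix (Fin 2) (Fin 2) ℂ => fderiv ℂ (logChartTwS F n K h U₀) X) 0 := rfl

end Coefficients

/-! ## §2 The J-term `T_J(U₀)` of (3.127) and `Δ₁` of record -/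

section JTerm

variable (F : T3Family) (n K : ℕ) (h : n ≤ K) (c₀ cB a : ℝ) [Fact (0 < c₀)] [Fact (0 < cB)]

/-- Print's `H(U₀)` of (3.126) on the route carriers (✓`H46`, the right inverse of `QTwS U₀` on the class) as a CONTINUOUS linear map (finite dimension). [cite: Balaban1985BackgroundPropagators, (3.126) p.420] -/
def H46L (U₀ : GaugeField (F.P K) 0 (Matrix.specialUnitaryGroup (Fin 2) ℂ)) : (PBond (F.P n) 0 → Matrix (Fin 2) (Fin 2) ℂ) →L[ℂ] (PBond (F.P K) 0 → Matrix (Fin 2) (Fin 2) ℂ) :=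
  LinearMap.toContinuousLinearMap (H46 F n K h c₀ cB a U₀)

/-- ★ **PRINT'S J-TERM AS A BILINEAR FORM ON THE EXPONENT FIELDS: `t_J[X, Y] := −⟨H(2C⁽²⁾[X, Y]), J⟩ = −actionGrad (H46 (avgHess X Y))`** — the polarised `−2⟨HC⁽²⁾(A), J⟩` of (3.127): the
change of the quadratic term of the action under the reparametrisation `X = X′ − H(½·2C⁽²⁾[X′, X′])` that linearises the averaging constraint. [cite: Balaban1985BackgroundPropagators, (3.127) p.421] -/
def tjForm (U₀ : GaugeField (F.P K) 0 (Matrix.specialUnitaryGroup (Fin 2) ℂ)) :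
    (PBond (F.P K) 0 → Matrix (Fin 2) (Fin 2) ℂ) →L[ℂ] (PBond (F.P K) 0 → Matrix (Fin 2) (Fin 2) ℂ) →L[ℂ] ℂ :=
  -((ContinuousLinearMap.compL ℂ (PBond (F.P K) 0 → Matrix (Fin 2) (Fin 2) ℂ) (PBond (F.P n) 0 → Matrix (Fin 2) (Fin 2) ℂ) ℂ
      ((actionGrad F K U₀).comp (H46L F n K h c₀ cB a U₀))).comp (avgHess F n K h U₀))

/-- **THE J-TERM AS A BOUNDED SESQUILINEAR FORM ON `L²`, IN PRINT'S NORMALISATION** — the formula of ✓`hessSesqRe` with `t_J` for `h`: `tjSesq U₀ v w := (−2c₀∕η²)·t_J[(toL2⁻¹v)ᴴ, toL2⁻¹w]`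
(same factor and same real structure `σ` in the conjugate-linear slot, so that `hessSesqRe + tjSesq` is the form of the reparametrised action). [cite: Balaban1985BackgroundPropagators, (3.127) p.421, (3.11)–(3.12) p.392] -/
def tjSesq (U₀ : GaugeField (F.P K) 0 (Matrix.specialUnitaryGroup (Fin 2) ℂ)) :
    BondL2K ℂ 3 (periodsT3 F K) c₀ W₂ →L⋆[ℂ] BondL2K ℂ 3 (periodsT3 F K) c₀ W₂ →L[ℂ] ℂ :=
  ((-(2 * (c₀ : ℂ)) / (((eta F n K : ℝ) : ℂ)) ^ 2) •
    ((ContinuousLinearMap.compL ℂ (BondL2K ℂ 3 (periodsT3 F K) c₀ W₂) (PBond (F.P K) 0 → Matrix (Fin 2) (Fin 2) ℂ) ℂ).flip (toL2CLM F K c₀))).comp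
      ((tjForm F n K h c₀ cB a U₀).comp
        (((starL ℂ : (PBond (F.P K) 0 → Matrix (Fin 2) (Fin 2) ℂ) ≃L⋆[ℂ] (PBond (F.P K) 0 → Matrix (Fin 2) (Fin 2) ℂ)) :
            (PBond (F.P K) 0 → Matrix (Fin 2) (Fin 2) ℂ) →L⋆[ℂ] (PBond (F.P K) 0 → Matrix (Fin 2) (Fin 2) ℂ)).comp
          (toL2CLM F K c₀)))

/-- ★★ **PRINT'S J-TERM OPERATOR `T_J(U₀)` ON THE WEIGHTED `L²` SPACE** — the bounded operator representing `tjSesq U₀`: `⟪T_J v, w⟫ = tjSesq U₀ v w` (Mathlib's `continuousLinearMapOfBilin`), so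
that `Δ^η(U₀) + T_J(U₀)` is the operator of print's form (3.127) in brick L0a's pairing. [cite: Balaban1985BackgroundPropagators, (3.127)–(3.128) p.421] -/
def TJ (U₀ : GaugeField (F.P K) 0 (Matrix.specialUnitaryGroup (Fin 2) ℂ)) : BondL2K ℂ 3 (periodsT3 F K) c₀ W₂ →L[ℂ] BondL2K ℂ 3 (periodsT3 F K) c₀ W₂ :=
  InnerProductSpace.continuousLinearMapOfBilin (tjSesq F n K h c₀ cB a U₀)

/-- **THE J-TERM IN THE SLOT TYPE OF ✓`DeltaOne`** (`U₀ ↦ (T_J(U₀) : L² →ₗ L²)`). [cite: Balaban1985BackgroundPropagators, (3.128) p.421] -/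
def TJSlot : GaugeField (F.P K) 0 (Matrix.specialUnitaryGroup (Fin 2) ℂ) → (BondL2K ℂ 3 (periodsT3 F K) c₀ W₂ →ₗ[ℂ] BondL2K ℂ 3 (periodsT3 F K) c₀ W₂) :=
  fun U₀ => (TJ F n K h c₀ cB a U₀ : BondL2K ℂ 3 (periodsT3 F K) c₀ W₂ →ₗ[ℂ] BondL2K ℂ 3 (periodsT3 F K) c₀ W₂)

/-- ★★ **`Δ₁` OF RECORD: `Δ₁(U₀) = Pᵀ(Δ^η(U₀) + T_J(U₀))P` WITH PRINT'S J-TERM** — brick L0b part 3's slot letter ✓`DeltaOne` at `T_J := TJSlot`. [cite: Balaban1985BackgroundPropagators, (3.127)–(3.128) p.421] -/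
def DeltaOneJ : GaugeField (F.P K) 0 (Matrix.specialUnitaryGroup (Fin 2) ℂ) → (BondL2K ℂ 3 (periodsT3 F K) c₀ W₂ →ₗ[ℂ] BondL2K ℂ 3 (periodsT3 F K) c₀ W₂) :=
  DeltaOne F n K h c₀ cB a (TJSlot F n K h c₀ cB a)

/-! ### Print's `G₁`, `(QG₁Q*)⁻¹`, `H₁`, `𝔊` and the EX readers AT THE J-TERM OF RECORD, by name -/

/-- **`G₁(U₀) = (Δ₁ + DRD* + aQ*Q)⁻¹` (3.128)∕(110) with the J-term of record** (✓`G1pi` at `TJSlot`). [cite: Balaban1985BackgroundPropagators, (3.128) p.421; Balaban1985Variational, (110) p.294] -/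
abbrev G1J (U₀ : GaugeField (F.P K) 0 (Matrix.specialUnitaryGroup (Fin 2) ℂ)) : BondL2K ℂ 3 (periodsT3 F K) c₀ W₂ →ₗ[ℂ] BondL2K ℂ 3 (periodsT3 F K) c₀ W₂ :=
  G1pi F n K h c₀ cB a (TJSlot F n K h c₀ cB a) U₀

/-- **`(QG₁Q*)⁻¹` with the J-term of record** (✓`Kinv1pi` at `TJSlot`). [cite: Balaban1985BackgroundPropagators, (3.129) p.421] -/
abbrev Kinv1J (U₀ : GaugeField (F.P K) 0 (Matrix.specialUnitaryGroup (Fin 2) ℂ)) : WL2 ℂ (fun _ : PBond (F.P n) 0 => cB) W₂ →ₗ[ℂ] WL2 ℂ (fun _ : PBond (F.P n) 0 => cB) W₂ :=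
  Kinv1pi F n K h c₀ cB a (TJSlot F n K h c₀ cB a) U₀

/-- **`H₁(U₀) = G₁Q*(QG₁Q*)⁻¹` (3.129) with the J-term of record** (✓`H1pi` at `TJSlot`). [cite: Balaban1985BackgroundPropagators, (3.129) p.421; Balaban1985Variational, (103) p.293] -/
abbrev H1J (U₀ : GaugeField (F.P K) 0 (Matrix.specialUnitaryGroup (Fin 2) ℂ)) : WL2 ℂ (fun _ : PBond (F.P n) 0 => cB) W₂ →ₗ[ℂ] BondL2K ℂ 3 (periodsT3 F K) c₀ W₂ :=
  H1pi F n K h c₀ cB a (TJSlot F n K h c₀ cB a) U₀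

/-- **`𝔊(U₀) = G₁𝔓*` (3.147)∕(111) with the J-term of record** (✓`frakG1pi` at `TJSlot`). [cite: Balaban1985BackgroundPropagators, (3.147) p.425; Balaban1985Variational, (111) p.294] -/
abbrev frakG1J (U₀ : GaugeField (F.P K) 0 (Matrix.specialUnitaryGroup (Fin 2) ℂ)) : BondL2K ℂ 3 (periodsT3 F K) c₀ W₂ →ₗ[ℂ] BondL2K ℂ 3 (periodsT3 F K) c₀ W₂ :=
  frakG1pi F n K h c₀ cB a (TJSlot F n K h c₀ cB a) U₀

/-- **The `h46tw`-type reader of `H₁` with the J-term of record** (✓`HfOne` at `TJSlot`). [cite: Balaban1985Variational, (45)–(46) p.285] -/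
abbrev HfJ (U₀ : GaugeField (F.P K) 0 (Matrix.specialUnitaryGroup (Fin 2) ℂ)) : (PBond (F.P n) 0 → Matrix (Fin 2) (Fin 2) ℂ) →ₗ[ℂ] (PBond (F.P K) 0 → Matrix (Fin 2) (Fin 2) ℂ) :=
  HfOne F n K h c₀ cB a (TJSlot F n K h c₀ cB a) U₀

variable [Fact (0 < (F.L : ℝ))] [Fact (0 < ((F.L : ℝ)⁻¹) ^ (K - n))]

/-- **THE EX LETTER `H₁f L i U₀` AT `Δ₁` OF RECORD** (✓`H1fOne` at `TJSlot`). [cite: Balaban1985Variational, (103) p.293, (115)–(117) pp.294–295] -/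
abbrev H1fJ (U₀ : GaugeField (F.P K) 0 (Matrix.specialUnitaryGroup (Fin 2) ℂ)) :
    (PBond (F.P n) 0 → Matrix (Fin 2) (Fin 2) ℂ) →L[ℂ]
      Space115 (F.L : ℝ) (((F.L : ℝ)⁻¹) ^ (K - n)) (fun _ : Bond 3 (periodsT3 F K) => K - n) (fun _ : Bond 3 (periodsT3 F K) × Fin 3 => K - n)
        (nabla115 (((F.L : ℝ)⁻¹) ^ (K - n)) (bgOfCfg F K U₀)) :=
  H1fOne F n K h c₀ cB a (TJSlot F n K h c₀ cB a) U₀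

/-- **THE EX LETTER `𝒢f L i U₀` AT `Δ₁` OF RECORD** (✓`frakGfOne` at `TJSlot`). [cite: Balaban1985Variational, (111) p.294, (115)–(117) pp.294–295] -/
abbrev frakGfJ (U₀ : GaugeField (F.P K) 0 (Matrix.specialUnitaryGroup (Fin 2) ℂ)) :
    NegSize (F.L : ℝ) (((F.L : ℝ)⁻¹) ^ (K - n)) (fun _ : Bond 3 (periodsT3 F K) => K - n) 3 (Matrix (Fin 2) (Fin 2) ℂ) →L[ℂ]
      Space115 (F.L : ℝ) (((F.L : ℝ)⁻¹) ^ (K - n)) (fun _ : Bond 3 (periodsT3 F K) => K - n) (fun _ : Bond 3 (periodsT3 F K) × Fin 3 => K - n)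
        (nabla115 (((F.L : ℝ)⁻¹) ^ (K - n)) (bgOfCfg F K U₀)) :=
  frakGfOne F n K h c₀ cB a (TJSlot F n K h c₀ cB a) U₀

end JTerm

/-! ## §3 Glue -/

section Glue

variable {F : T3Family} {n K : ℕ} {h : n ≤ K} {c₀ cB a : ℝ} [Fact (0 < c₀)] [Fact (0 < cB)]

/-- `H46L` is `H46`. [cite: Balaban1985BackgroundPropagators, (3.126) p.420] -/
theorem H46L_apply (U₀ : GaugeField (F.P K) 0 (Matrix.specialUnitaryGroup (Fin 2) ℂ)) (Y : PBond (F.P n) 0 → Matrix (Fin 2) (Fin 2) ℂ) :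
    H46L F n K h c₀ cB a U₀ Y = H46 F n K h c₀ cB a U₀ Y := rfl

/-- ★ **THE J-TERM FORMULA: `t_J[X, Y] = −actionGrad (H46 (avgHess X Y))`** (print's `−2⟨HC⁽²⁾(A), J⟩`, polarised). [cite: Balaban1985BackgroundPropagators, (3.127) p.421] -/
theorem tjForm_apply (U₀ : GaugeField (F.P K) 0 (Matrix.specialUnitaryGroup (Fin 2) ℂ)) (X Y : PBond (F.P K) 0 → Matrix (Fin 2) (Fin 2) ℂ) :
    tjForm F n K h c₀ cB a U₀ X Y = -actionGrad F K U₀ (H46 F n K h c₀ cB a U₀ (avgHess F n K h U₀ X Y)) := by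
  simp [tjForm, H46L]

/-- Unfolding the sesquilinear form: `tjSesq U₀ v w = (−2c₀∕η²) · t_J[(toL2⁻¹ v)ᴴ, toL2⁻¹ w]`. [cite: Balaban1985BackgroundPropagators, (3.127) p.421] -/
theorem tjSesq_apply (U₀ : GaugeField (F.P K) 0 (Matrix.specialUnitaryGroup (Fin 2) ℂ)) (v w : BondL2K ℂ 3 (periodsT3 F K) c₀ W₂) :
    tjSesq F n K h c₀ cB a U₀ v w =
      ((-(2 * (c₀ : ℂ)) / (((eta F n K : ℝ) : ℂ)) ^ 2)) * tjForm F n K h c₀ cB a U₀ (star ((toL2 F K c₀).symm v)) ((toL2 F K c₀).symm w) := by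
  simp [tjSesq, toL2CLM]

/-- ★ **THE DEFINING PROPERTY OF `T_J(U₀)`: `⟪T_J v, w⟫ = tjSesq U₀ v w`.** [cite: Balaban1985BackgroundPropagators, (3.127)–(3.128) p.421] -/
theorem inner_TJ_left (U₀ : GaugeField (F.P K) 0 (Matrix.specialUnitaryGroup (Fin 2) ℂ)) (v w : BondL2K ℂ 3 (periodsT3 F K) c₀ W₂) :
    ⟪TJ F n K h c₀ cB a U₀ v, w⟫_ℂ = tjSesq F n K h c₀ cB a U₀ v w :=
  InnerProductSpace.continuousLinearMapOfBilin_apply (tjSesq F n K h c₀ cB a U₀) v w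

/-- Unfolding the slot. [cite: Balaban1985BackgroundPropagators, (3.128) p.421] -/
theorem TJSlot_apply (U₀ : GaugeField (F.P K) 0 (Matrix.specialUnitaryGroup (Fin 2) ℂ)) (v : BondL2K ℂ 3 (periodsT3 F K) c₀ W₂) :
    TJSlot F n K h c₀ cB a U₀ v = TJ F n K h c₀ cB a U₀ v := rfl

/-- `Δ₁` of record is ✓`DeltaOne` at the J-term of record. [cite: Balaban1985BackgroundPropagators, (3.128) p.421] -/
theorem DeltaOneJ_def : DeltaOneJ F n K h c₀ cB a = DeltaOne F n K h c₀ cB a (TJSlot F n K h c₀ cB a) := rfl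

/-- **(3.128) AS A FORM AT THE J-TERM OF RECORD: `⟪A′, Δ₁A⟫ = ⟪PA′, Δ^η(PA)⟫ + tjSesq (PA′) (PA)`.** [cite: Balaban1985BackgroundPropagators, (3.127)–(3.128) p.421] -/
theorem inner_DeltaOneJ (U₀ : GaugeField (F.P K) 0 (Matrix.specialUnitaryGroup (Fin 2) ℂ)) (A' A : BondL2K ℂ 3 (periodsT3 F K) c₀ W₂) :
    ⟪A', DeltaOneJ F n K h c₀ cB a U₀ A⟫_ℂ =
      ⟪gaugeCorr F n K h c₀ cB a U₀ A', DeltaEta F n K c₀ U₀ (gaugeCorr F n K h c₀ cB a U₀ A)⟫_ℂ +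
        conj (tjSesq F n K h c₀ cB a U₀ (gaugeCorr F n K h c₀ cB a U₀ A) (gaugeCorr F n K h c₀ cB a U₀ A')) := by
  rw [DeltaOneJ_def, inner_DeltaOne, TJSlot_apply, ← inner_conj_symm _ (TJ F n K h c₀ cB a U₀ _), inner_TJ_left]

/-! ### At a critical background the J-term vanishes and `Δ₁ = Δ_π` there -/

/-- ★ `J = 0 ⇒ t_J = 0`. [cite: Balaban1985BackgroundPropagators, (3.127) p.421] -/
theorem tjForm_eq_zero_of_actionGrad_eq_zero {U₀ : GaugeField (F.P K) 0 (Matrix.specialUnitaryGroup (Fin 2) ℂ)} (hJ : actionGrad F K U₀ = 0) :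
    tjForm F n K h c₀ cB a U₀ = 0 := by
  ext X Y
  rw [tjForm_apply, hJ, zero_apply, neg_zero, zero_apply, zero_apply]

/-- ★★ **AT A CRITICAL BACKGROUND (`J(U₀) = 0`) THE J-TERM OPERATOR VANISHES: `T_J(U₀) = 0`.** [cite: Balaban1985BackgroundPropagators, (3.127) p.421] -/
theorem TJ_eq_zero_of_actionGrad_eq_zero {U₀ : GaugeField (F.P K) 0 (Matrix.specialUnitaryGroup (Fin 2) ℂ)} (hJ : actionGrad F K U₀ = 0) :
    TJ F n K h c₀ cB a U₀ = 0 := by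
  refine ContinuousLinearMap.ext fun v => ext_inner_right ℂ fun w => ?_
  rw [inner_TJ_left, tjSesq_apply, tjForm_eq_zero_of_actionGrad_eq_zero hJ, zero_apply, zero_apply, mul_zero,
    zero_apply, inner_zero_left]

/-- … hence **`Δ₁(U₀) = Δ_π(U₀)` at a critical background** (✓`DeltaOne_zero` pointwise). [cite: Balaban1985BackgroundPropagators, (3.128) p.421, (3.119) p.419] -/
theorem DeltaOneJ_apply_eq_DeltaPi_of_actionGrad_eq_zero {U₀ : GaugeField (F.P K) 0 (Matrix.specialUnitaryGroup (Fin 2) ℂ)} (hJ : actionGrad F K U₀ = 0)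
    (A : BondL2K ℂ 3 (periodsT3 F K) c₀ W₂) :
    DeltaOneJ F n K h c₀ cB a U₀ A = DeltaPiSlot F n K h c₀ cB a U₀ A := by
  rw [DeltaOneJ_def, DeltaOne_apply, TJSlot_apply, TJ_eq_zero_of_actionGrad_eq_zero hJ, zero_apply, add_zero]
  rfl

end Glue

end Summit.QuantumFields.YangMills.Theorems.Prop7SectET3DeltaOne

end
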